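import Literature.NumberTheory.EllipticCurves.Kato2004.IwasawaH1ReductionKernel
import Literature.NumberTheory.EllipticCurves.GaloisActionProofs
import Literature.NumberTheory.GaloisRepresentations.ContinuousCorestrictionComp
import Literature.NumberTheory.GaloisRepresentations.AbsGaloisOuterConj
import Literature.NumberTheory.GaloisRepresentations.AbsIntegersEquiv
import Literature.NumberTheory.GaloisRepresentations.CyclotomicCharacterFrobeniusProofs
import Literature.NumberTheory.GaloisRepresentations.IntegralGaloisActionProofs
import HarnessLib

/-!
# K6 crux `MuTransferX9` (stmt-BirchSwinnertonDyer-19276), named fact F2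
# `Kato2004.mem_pSmul_of_red_eq_zero` (aside 19844): TOOLS for Kato's Lemma 8.5 (2) in the pin's
# currency (companion file `…X9NormCompatibleIntegral`, theorem
# `UniversalNorms.mem_integralH1_of_layerCores_eq_of_smul_mem`)

Cell `bsd-smallim`, seat `bsd-smallim-k6-lur-a` (gen 2).  THEOREMS ONLY (no definition, no named fact):
* §1 `sum_range_pow_eq_zero_of_periodic` (pure algebra): a `p^k`-periodic, shift-deterministic sequence of
  `p`-torsion elements with values in a finite set of size `< p^k` sums to `0` over `i < p^k` (pigeonhole:
  a period `≤ #set`; the least period divides `p^k`, hence `p^(k-1)`; the sum is `p • (…) = 0`).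
* §2 `resLe_coresLe_eq_zero_of_forall_primesAbove`: `cor_{V → U}` (`V ⊴ Γ_ℚ`, `U ∩ I_𝔓 ⊆ V` for
  `𝔓 ∣ v`) preserves "the restriction to `Γ ∩ I_𝔓'` vanishes for EVERY `𝔓' ∣ v`" at CLASS level (per-place
  form of koly's `TameClass.coresLe_mem_integralH1_of_inertia_le`; NSW (1.5.7), normal case).
* §3 `finite_setOf_smul_eq_zero`: the `p`-torsion classes of `H¹(I, T_pW)` form a finite set (`[z]` with
  `p z = ∂m` is determined by `m mod p ∈ E(ℚ̄)[p]`; k6-g4's `TateModule` lemmas, `finite_torsionPoints_holds`).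
* §4 `exists_generator`: for the CYCLOTOMIC `κ` and `v ≠ p` there is a layer `n₀` above which every prime
  over `v` is inert: for `n' ≥ n₀`, `k`, `𝔓 ∣ v` some `φ ∈ D_𝔓 ∩ Γ_{n'}` generates `Γ_{n'}/Γ_{n'+k}` (`κ` takes
  one value `a ≠ 0` on all Frobenius elements over `v`: `χ_p(Frob) = N v` has infinite order and
  `ker κ = χ_p⁻¹(torsion)`; `n₀ = v_p(a)`, `φ = Frob^(p^(n'-n₀))`).

References: Kato, Astérisque 295 (2004), §8.2, Lemma 8.5, §13.8 [Kato2004Asterisque]; NSW (2008), I §5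
(1.5.6)–(1.5.7) [NeukirchSchmidtWingberg2008]; Washington (1997), §13.1–13.2 [Washington1997]; Serre (1968),
I §1.1–1.2 [Serre1968]; Silverman, AEC (2009), Cor. III.6.4 [SilvermanAEC2009]. -/

noncomputable section

open scoped NumberField Pointwise
open CategoryTheory Field IsDedekindDomain
open Literature.NumberTheory.GaloisRepresentations
open Literature.NumberTheory.EllipticCurves
open Literature.NumberTheory.EllipticCurves.ZpExtension
open Literature.NumberTheory.EllipticCurves.Kato2004
open Literature.NumberTheory.EllipticCurves.Kato2004.EulerSystemValues
open Rat.HeightOneSpectrum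

set_option linter.dupNamespace false

namespace Summit.BirchSwinnertonDyer.BirchSwinnertonDyer.Rank1Residual.UniversalNorms

/-! ## §1 A periodic shift-deterministic sequence of `p`-torsion elements in a small set sums to zero -/

section Periodic

variable {B : Type*} [AddCommMonoid B]

omit [AddCommMonoid B] in
/-- A `Q`-periodic sequence is `c * Q`-periodic. [folklore] -/
theorem periodic_mul {a : ℕ → B} {Q : ℕ} (hQ : ∀ s, a (s + Q) = a s) (c : ℕ) :
    ∀ s, a (s + c * Q) = a s := by
  induction c with
  | zero => intro s; rw [zero_mul, add_zero]
  | succ c ih => intro s; rw [Nat.succ_mul, ← add_assoc, hQ, ih]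

/-- The sum of a `Q`-periodic sequence over `c` periods is `c •` the sum over one period. [folklore] -/
theorem sum_range_mul_eq_smul_of_periodic {a : ℕ → B} {Q : ℕ} (hQ : ∀ s, a (s + Q) = a s) (c : ℕ) :
    ∑ i ∈ Finset.range (c * Q), a i = c • ∑ i ∈ Finset.range Q, a i := by
  induction c with
  | zero => rw [zero_mul, Finset.range_zero, Finset.sum_empty, zero_smul]
  | succ c ih =>
    rw [Nat.succ_mul, Finset.sum_range_add, ih, succ_nsmul]
    congr 1
    refine Finset.sum_congr rfl fun i _ => ?_
    rw [add_comm, periodic_mul hQ c i]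

/-- **Periodicity lemma.**  Let `a : ℕ → B` take values in a finite set `S` with `#S < p ^ k`, be
`p ^ k`-periodic and SHIFT-DETERMINISTIC (`a i = a j → a (i+1) = a (j+1)`), and consist of `p`-torsion
elements.  Then `∑_{i < p^k} a i = 0`: by pigeonhole `a` has a period `d ≤ #S < p ^ k`, the periods of
`a` are the multiples of a least period `g ∣ p ^ k` with `g ≤ d`, so `g ∣ p ^ (k-1)` and the sum is
`p • ∑_{i < p^(k-1)} a i = 0`. [folklore] -/
theorem sum_range_pow_eq_zero_of_periodic {p : ℕ} (hp : p.Prime) (a : ℕ → B) {S : Finset B}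
    (haS : ∀ i, a i ∈ S) {k : ℕ} (hcard : S.card < p ^ k) (hper : ∀ i, a (i + p ^ k) = a i)
    (hdet : ∀ i j, a i = a j → a (i + 1) = a (j + 1)) (htor : ∀ i, p • a i = 0) :
    ∑ i ∈ Finset.range (p ^ k), a i = 0 := by
  classical
  -- pigeonhole: `a i = a j` for some `i < j ≤ #S`
  obtain ⟨i, hi, j, hj, hij, hija⟩ := Finset.exists_ne_map_eq_of_card_lt_of_maps_to
    (s := Finset.range (S.card + 1)) (t := S) (f := a) (by simp) (fun x _ => haS x)
  wlog hlt : i < j generalizing i j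
  · exact this j hj i hi hij.symm hija.symm (lt_of_le_of_ne (not_lt.mp hlt) hij.symm)
  have hshift : ∀ t, a (i + t) = a (j + t) := by
    intro t
    induction t with
    | zero => simpa using hija
    | succ t ih => rw [← add_assoc, ← add_assoc]; exact hdet _ _ ih
  -- the period `d = j - i`
  set d := j - i with hd
  have hdpos : 0 < d := by omega
  have hdle : d < p ^ k := by
    have : j ≤ S.card := by simpa [Finset.mem_range, Nat.lt_succ_iff] using hj
    omega
  have hperL : ∀ L s, a (s + L * p ^ k) = a s := fun L => periodic_mul hper L
  have hdper : ∀ s, a (s + d) = a s := by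
    intro s
    have hk1 : 1 ≤ p ^ k := Nat.one_le_pow _ _ hp.pos
    obtain ⟨Q, hQ⟩ : ∃ Q, p ^ k = Q + 1 := ⟨p ^ k - 1, by omega⟩
    have e1 : s + d + i * p ^ k = j + (s + i * Q) := by
      rw [hQ, mul_add, mul_one]; omega
    have e2 : i + (s + i * Q) = s + i * p ^ k := by
      rw [hQ, mul_add, mul_one]; omega
    rw [← hperL i (s + d), e1, ← hshift, e2, hperL]
  -- the least positive period `g` divides every period
  have hex : ∃ e, 0 < e ∧ ∀ s, a (s + e) = a s := ⟨d, hdpos, hdper⟩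
  set g := Nat.find hex with hg
  have hgper : ∀ s, a (s + g) = a s := (Nat.find_spec hex).2
  have hgpos : 0 < g := (Nat.find_spec hex).1
  have hgle : g ≤ d := Nat.find_min' hex ⟨hdpos, hdper⟩
  have hgdvd : ∀ e, (∀ s, a (s + e) = a s) → g ∣ e := by
    intro e
    induction e using Nat.strong_induction_on with
    | _ e ih =>
      intro he
      rcases Nat.eq_zero_or_pos e with rfl | hepos
      · exact dvd_zero _
      by_cases hlt : e < g
      · exact absurd ⟨hepos, he⟩ (Nat.find_min hex hlt)
      · have hge : g ≤ e := not_lt.mp hlt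
        have he' : ∀ s, a (s + (e - g)) = a s := fun s => by
          rw [← hgper (s + (e - g)), add_assoc, Nat.sub_add_cancel hge, he]
        have := ih (e - g) (by omega) he'
        have heq : e = (e - g) + g := (Nat.sub_add_cancel hge).symm
        rw [heq]
        exact dvd_add this (dvd_refl g)
  -- `g ∣ p ^ k`, `g ≤ d < p ^ k`, hence `g ∣ p ^ (k - 1)`
  obtain ⟨b, hbk, hgb⟩ := (Nat.dvd_prime_pow hp).mp (hgdvd (p ^ k) hper)
  have hbk' : b < k := by
    by_contra hbk'
    have hbk'' : b = k := le_antisymm hbk (not_lt.mp hbk')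
    rw [hbk''] at hgb
    omega
  have hk : k = (k - 1) + 1 := by omega
  have hgdvd' : g ∣ p ^ (k - 1) := by
    rw [hgb]; exact pow_dvd_pow p (by omega)
  obtain ⟨c, hc⟩ := hgdvd'
  have hQper : ∀ s, a (s + p ^ (k - 1)) = a s := by
    intro s; rw [hc, mul_comm]; exact periodic_mul hgper c s
  rw [hk, pow_succ, mul_comm, sum_range_mul_eq_smul_of_periodic hQper p, Finset.smul_sum]
  exact Finset.sum_eq_zero fun i _ => htor i

end Periodic

/-! ## §2 Relative corestriction preserves "unramified at `v`" at CLASS level (per place) -/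

section CoresPlace

variable {A : Type} [CommRing A] [TopologicalSpace A]
variable {M : Type} [AddCommGroup M] [Module A M] [TopologicalSpace M] [IsTopologicalAddGroup M]
  [ContinuousSMul A M]

/-- For `V` normal, elements of `V` act trivially on `U/V` (copy of the private lemma of
`Kato2004/IntegralH1Corestriction`). [cite: NeukirchSchmidtWingberg2008, I §5 (1.5.7)] -/
private theorem smul_eq_self_of_mem' {G : Type*} [Group G] {N U : Subgroup G} [N.Normal] {n : U}
    (hn : (n : G) ∈ N) (x : U ⧸ N.subgroupOf U) : n • x = x := by
  induction x using QuotientGroup.induction_on with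
  | H u =>
    rw [MulAction.Quotient.smul_mk, QuotientGroup.eq, Subgroup.mem_subgroupOf, smul_eq_mul]
    have : (((n * u)⁻¹ * u : U) : G) = (u : G)⁻¹ * (n : G)⁻¹ * ((u : G)⁻¹)⁻¹ := by
      push_cast; group
    rw [this]
    exact Subgroup.Normal.conj_mem inferInstance _ (N.inv_mem hn) _

open Literature.NumberTheory.EllipticCurves (schreierElt schreierElt_mem schreierElt_coe
  rep_mul_schreierElt subgroupInclusion subgroupInclusion_apply_coe) in
/-- **`cor_{V → U}` preserves the classes unramified at `v`, per place, at CLASS level.**  Let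
`V ⊴ Γ_ℚ` be open of finite index in `U ≥ V`, with `U ∩ I_𝔓 ⊆ V` for every `𝔓 ∣ v`.  If
`res_{V ∩ I_𝔓'} x = 0` for EVERY `𝔓' ∣ v`, then `res_{U ∩ I_𝔓} (cor x) = 0` for every `𝔓 ∣ v`: on cocycles
`(cor_s φ)(g) = Σ_x s(x)·φ(s(x)⁻¹ g s(x))` for `g ∈ U ∩ I_𝔓` (trivial on `U/V`), each `φ|_{V ∩ I_{s(x)⁻¹𝔓}}`
is a coboundary `∂w_x`, whence `cor_s φ|_{U ∩ I_𝔓} = ∂(Σ_x s(x)·w_x)` (per-place form of the tree's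
`TameClass.coresLe_mem_integralH1_of_inertia_le`). [cite: Kato2004Asterisque, §8.2 and Lemma 8.5 (pp. 180–184)]
[cite: NeukirchSchmidtWingberg2008, I §5 (1.5.7)] -/
theorem resLe_coresLe_eq_zero_of_forall_primesAbove (T : GaloisRep ℚ A M)
    {V U : Subgroup (absoluteGaloisGroup ℚ)} [V.Normal] (h : V ≤ U)
    (hV : IsOpen (V : Set (absoluteGaloisGroup ℚ))) [Fintype (U ⧸ V.subgroupOf U)]
    {v : HeightOneSpectrum (𝓞 ℚ)}
    (hunr : ∀ 𝔓 ∈ v.primesAbove, ∀ g ∈ U, g ∈ 𝔓.inertia (absoluteGaloisGroup ℚ) → g ∈ V)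
    {x : H1 T V}
    (hx : ∀ 𝔓 ∈ v.primesAbove,
      resLe T.toTopRep (inf_le_left : V ⊓ 𝔓.inertia (absoluteGaloisGroup ℚ) ≤ V) 1 x = 0)
    {𝔓 : Ideal (absIntegers (𝓞 ℚ) ℚ)} (h𝔓 : 𝔓 ∈ v.primesAbove) :
    resLe T.toTopRep (inf_le_left : U ⊓ 𝔓.inertia (absoluteGaloisGroup ℚ) ≤ U) 1
      (coresLe T.toTopRep h hV x) = 0 := by
  obtain ⟨φ, rfl⟩ := oneCocycleClass_surjective _ x
  -- representatives of `U/V`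
  have hs : ∀ y : U ⧸ V.subgroupOf U, ((Quotient.out y : U) : U ⧸ V.subgroupOf U) = y :=
    fun y ↦ QuotientGroup.out_eq' y
  -- `φ` is a coboundary on `V ∩ I_{𝔓'}` for every `𝔓' ∣ v`: choose the witnesses at the conjugates
  have hcob : ∀ y : U ⧸ V.subgroupOf U, ∃ w : M,
      ∀ g : ↥(V ⊓ ((((Quotient.out y : U) : absoluteGaloisGroup ℚ)⁻¹ • 𝔓).inertia
        (absoluteGaloisGroup ℚ))),
      φ.1 (subgroupInclusion inf_le_left g) = T.toTopRep.ρ (g : absoluteGaloisGroup ℚ) w - w := by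
    intro y
    have h0 := hx _ (smul_mem_primesAbove h𝔓 ((Quotient.out y : U) : absoluteGaloisGroup ℚ)⁻¹)
    rw [resLe_oneCocycleClass, oneCocycleClass_eq_zero_iff] at h0
    obtain ⟨w, hw⟩ := h0
    exact ⟨w, fun g ↦ hw g⟩
  choose w hw using hcob
  rw [coresLe_oneCocycleClass T.toTopRep h hV hs φ, resLe_oneCocycleClass, oneCocycleClass_eq_zero_iff]
  refine ⟨∑ y, T.toTopRep.ρ ((Quotient.out y : U) : absoluteGaloisGroup ℚ) (w y), fun g ↦ ?_⟩
  -- `g ∈ U ∩ I_𝔓`, hence `g ∈ V` and it acts trivially on `U/V`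
  have hgI : (g : absoluteGaloisGroup ℚ) ∈ 𝔓.inertia (absoluteGaloisGroup ℚ) := g.2.2
  have hgV : (g : absoluteGaloisGroup ℚ) ∈ V := hunr 𝔓 h𝔓 _ g.2.1 hgI
  rw [contOneCocycles.pullback_apply, TopRep.hom_ofHom]
  change (transferCocycle (subgroupRep T.toTopRep U) (V.subgroupOf U) (isOpen_subgroupOf U hV) hs
      (contOneCocycles.pullback (subgroupOfHom h)
        (Y := subgroupRep (subgroupRep T.toTopRep U) (V.subgroupOf U))
        (TopRep.ofHom ⟨ContinuousLinearMap.id A M, fun _ => rfl⟩) φ)).1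
      (subgroupInclusion (inf_le_left : U ⊓ 𝔓.inertia (absoluteGaloisGroup ℚ) ≤ U) g) = _
  rw [transferCocycle_pullback_apply T.toTopRep h hV hs, map_sum, ← Finset.sum_sub_distrib]
  refine Finset.sum_congr rfl fun y _ ↦ ?_
  have hgy : subgroupInclusion (inf_le_left : U ⊓ 𝔓.inertia (absoluteGaloisGroup ℚ) ≤ U) g • y = y :=
    smul_eq_self_of_mem' (by simpa [subgroupInclusion_apply_coe] using hgV) y
  -- the Schreier element `s(y)⁻¹ g s(y)` lies in `V ∩ I_{s(y)⁻¹ 𝔓}`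
  set σ : absoluteGaloisGroup ℚ := ((Quotient.out y : U) : absoluteGaloisGroup ℚ) with hσ
  have hmemI : σ⁻¹ * (g : absoluteGaloisGroup ℚ) * σ ∈ (σ⁻¹ • 𝔓).inertia (absoluteGaloisGroup ℚ) := by
    have := (Ideal.conj_mem_inertia_smul_iff 𝔓 σ⁻¹ (g : absoluteGaloisGroup ℚ)).mpr hgI
    simpa using this
  have hmemV : σ⁻¹ * (g : absoluteGaloisGroup ℚ) * σ ∈ V :=
    Subgroup.Normal.conj_mem' inferInstance _ hgV σ
  have key := hw y ⟨σ⁻¹ * (g : absoluteGaloisGroup ℚ) * σ, hmemV, hmemI⟩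
  have harg : subgroupOfHom h (schreierElt (V.subgroupOf U) hs
        (subgroupInclusion (inf_le_left : U ⊓ 𝔓.inertia (absoluteGaloisGroup ℚ) ≤ U) g) y) =
      subgroupInclusion inf_le_left ⟨σ⁻¹ * (g : absoluteGaloisGroup ℚ) * σ, hmemV, hmemI⟩ := by
    apply Subtype.ext
    rw [subgroupOfHom_apply_coe, schreierElt_coe, hgy, subgroupInclusion_apply_coe]
    simp [hσ, subgroupInclusion_apply_coe]
  have key' : φ.1 (subgroupInclusion inf_le_left ⟨σ⁻¹ * (g : absoluteGaloisGroup ℚ) * σ, hmemV, hmemI⟩) =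
      T.toTopRep.ρ (σ⁻¹ * (g : absoluteGaloisGroup ℚ) * σ) (w y) - w y := key
  rw [hgy, harg, key', map_sub, subgroupRep_ρ_apply, ← ρ_mul_apply, ← ρ_mul_apply, ← hσ]
  have hprod : σ * (σ⁻¹ * (g : absoluteGaloisGroup ℚ) * σ) = (g : absoluteGaloisGroup ℚ) * σ := by
    group
  rw [hprod]

end CoresPlace

/-! ## §3 The `p`-torsion of `H¹(I, T_pW)` is finite -/

section TorsionFinite

variable (W : WeierstrassCurve ℚ) [W.IsElliptic] (p : ℕ) [Fact p.Prime]
  [ContinuousSMul ℤ_[p] (W.tateModule p)]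

/-- **The `p`-torsion classes of `H¹(I, T_pW)` form a finite set**, for every subgroup `I ≤ Γ_ℚ`:
a class `[z]` with `p • [z] = 0` has `p • z = ∂m`, and `[z]` depends only on `m mod p ∈ W[p]`
(`T_pW` has no `p`-torsion and `ker (T_pW → W[p]) = p·T_pW`, `TateModule.eq_of_prime_nsmul_eq`,
`TateModule.exists_prime_nsmul_eq_of_proj_one_eq_zero`), and `W[p] = E(ℚ̄)[p]` is finite
(`finite_torsionPoints_holds`). [cite: Serre1968, Ch. I §1.1] [cite: SilvermanAEC2009, Cor. III.6.4] -/
theorem finite_setOf_smul_eq_zero (I : Subgroup (absoluteGaloisGroup ℚ)) :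
    {c : H1 (tateRep W p) I | (p : ℤ_[p]) • c = 0}.Finite := by
  classical
  haveI : Finite (WeierstrassCurve.geomTorsion W (p : ℤ)) :=
    WeierstrassCurve.finite_torsionPoints_holds W (AlgebraicClosure ℚ)
      (by exact_mod_cast (Fact.out : p.Prime).ne_zero)
  set X := subgroupRep (tateRep W p).toTopRep I with hX
  let F : WeierstrassCurve.geomTorsion W (p : ℤ) → H1 (tateRep W p) I := fun P =>
    if h : ∃ c : H1 (tateRep W p) I, ∃ z : contOneCocycles X, ∃ m : W.tateModule p,
        oneCocycleClass X z = c ∧ (∀ g, ((p : ℤ_[p]) • z).1 g = X.ρ g m - m) ∧ tateModP W p m = P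
      then h.choose else 0
  refine (Set.finite_range F).subset ?_
  intro c hc
  obtain ⟨z, rfl⟩ := oneCocycleClass_surjective _ c
  have h0 : oneCocycleClass X ((p : ℤ_[p]) • z) = 0 := by
    rw [oneCocycleClass_smul]; exact hc
  obtain ⟨m, hm⟩ := (oneCocycleClass_eq_zero_iff X _).mp h0
  refine ⟨tateModP W p m, ?_⟩
  have hex : ∃ c : H1 (tateRep W p) I, ∃ z' : contOneCocycles X, ∃ m' : W.tateModule p,
      oneCocycleClass X z' = c ∧ (∀ g, ((p : ℤ_[p]) • z').1 g = X.ρ g m' - m') ∧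
        tateModP W p m' = tateModP W p m :=
    ⟨_, z, m, rfl, hm, rfl⟩
  simp only [F, dif_pos hex]
  obtain ⟨z', m', hc', hm', hP⟩ := hex.choose_spec
  rw [← hc', ← sub_eq_zero, ← oneCocycleClass_sub, oneCocycleClass_eq_zero_iff]
  -- `m' - m ∈ ker (a ↦ a_1) = p · T_pW`
  have h1 : TateModule.proj p 1 (m' - m) = 0 := by
    have := congrArg (fun P : WeierstrassCurve.geomTorsion W (p : ℤ) => (P : WeierstrassCurve.geomPoints W)) hP
    simp only [coe_tateModP_apply] at this
    rw [map_sub, this, sub_self]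
  obtain ⟨t, ht, -⟩ := TateModule.exists_prime_nsmul_eq_of_proj_one_eq_zero (m' - m) h1
  refine ⟨t, fun g => ?_⟩
  rw [Submodule.coe_sub, ContinuousMap.sub_apply]
  apply TateModule.eq_of_prime_nsmul_eq
  have e1 : p • z'.1 g = X.ρ g m' - m' := by
    have := hm' g
    rwa [Submodule.coe_smul, ContinuousMap.smul_apply, Nat.cast_smul_eq_nsmul] at this
  have e2 : p • z.1 g = X.ρ g m - m := by
    have := hm g
    rwa [Submodule.coe_smul, ContinuousMap.smul_apply, Nat.cast_smul_eq_nsmul] at this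
  rw [nsmul_sub, e1, e2, nsmul_sub, ← map_nsmul, ht, map_sub]
  abel

end TorsionFinite

/-! ## §4 Above some layer every prime over `v ≠ p` is inert in a cyclotomic `ℤ_p`-extension:
Frobenius generators of `Γ_{n'}/Γ_{n'+k}` -/

section Generator

variable {p : ℕ} [Fact p.Prime] (κ : ZpExtension ℚ p)

/-- **Frobenius generators of the layers.**  For the cyclotomic `ℤ_p`-extension `κ` and a prime
`v ≠ p` there is a layer `n₀` such that for all `n' ≥ n₀`, all `k` and every `𝔓 ∣ v`, some element `φ`
of the decomposition group of `𝔓` (`φ • 𝔓 = 𝔓`) lies in `Γ_{n'} = Gal(ℚ̄/ℚ_{n'})` and its class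
GENERATES `Γ_{n'}/Γ_{n'+k}` (above `ℚ_{n₀}` every prime over `v` is inert in `ℚ_∞`): `κ` takes ONE
value `a ≠ 0` on all arithmetic Frobenius elements over `v` (`χ_p(Frob) = N v`,
`GaloisRep.cyclotomicCharacter_apply_of_isArithFrobAt`, has infinite order, and `ker κ = χ_p⁻¹(torsion)`),
`n₀ = v_p(a)`, `φ = Frob ^ (p ^ (n' − n₀))`. [cite: Washington1997, Prop. 13.2] [cite: SerreAbelianLadic1968, Ch. I §1.2] -/
theorem exists_generator (hκ : κ.IsCyclotomic) {v : HeightOneSpectrum (𝓞 ℚ)}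
    (hv : (p : 𝓞 ℚ) ∉ v.asIdeal) {𝔓₀ : Ideal (absIntegers (𝓞 ℚ) ℚ)} (h𝔓₀ : 𝔓₀ ∈ v.primesAbove) :
    ∃ n₀ : ℕ, ∀ 𝔓 ∈ v.primesAbove, ∀ n', n₀ ≤ n' → ∀ k : ℕ,
      ∃ φ : absoluteGaloisGroup ℚ, φ • 𝔓 = 𝔓 ∧ φ ∈ κ.layerSubgroup n' ∧
        ∀ u ∈ κ.layerSubgroup n', ∃ i : ℕ, (φ ^ i)⁻¹ * u ∈ κ.layerSubgroup (n' + k) := by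
  classical
  have hp : p.Prime := Fact.out
  obtain ⟨σ₀, hσ₀⟩ :=
    HeightOneSpectrum.exists_isArithFrobAt_of_mem_primesAbove_holds (K := ℚ) (v := v) h𝔓₀
  -- `ker κ = χ_p⁻¹(torsion)`
  have hker : ∀ τ : absoluteGaloisGroup ℚ,
      τ ∈ κ.kerSubgroup ↔ IsOfFinOrder (GaloisRep.cyclotomicCharacter ℚ p τ) := by
    intro τ
    rw [hκ, Subgroup.mem_comap, CommGroup.mem_torsion]
    rfl
  set a : ℤ_[p] := (κ σ₀).toAdd with ha
  have ha0 : a ≠ 0 := by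
    intro h0
    have h1 : κ σ₀ = 1 := by
      rw [← ofAdd_toAdd (κ σ₀)]
      change Multiplicative.ofAdd a = 1
      rw [h0]
      rfl
    exact GaloisRep.cyclotomicCharacter_frob_not_isOfFinOrder hv h𝔓₀ hσ₀
      ((hker σ₀).mp (ZpExtension.mem_kerSubgroup.mpr h1))
  refine ⟨a.valuation, fun 𝔓 h𝔓 n' hn' k => ?_⟩
  obtain ⟨σ, hσ⟩ :=
    HeightOneSpectrum.exists_isArithFrobAt_of_mem_primesAbove_holds (K := ℚ) (v := v) h𝔓
  -- `κ σ = κ σ₀`: both Frobenius elements have `χ_p = N v`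
  have hκσ : (κ σ).toAdd = a := by
    have hχ : GaloisRep.cyclotomicCharacter ℚ p σ = GaloisRep.cyclotomicCharacter ℚ p σ₀ := by
      apply Units.ext
      rw [GaloisRep.cyclotomicCharacter_apply_of_isArithFrobAt hv h𝔓 hσ,
        GaloisRep.cyclotomicCharacter_apply_of_isArithFrobAt hv h𝔓₀ hσ₀]
    have hmem : σ₀⁻¹ * σ ∈ κ.kerSubgroup := by
      rw [hker, map_mul, map_inv, hχ, inv_mul_cancel]
      exact IsOfFinOrder.one
    rw [ZpExtension.mem_kerSubgroup, map_mul, map_inv, inv_mul_eq_one] at hmem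
    rw [ha, hmem]
  -- the unit part of `a`
  set uu : ℤ_[p]ˣ := PadicInt.unitCoeff ha0 with huu
  have hau : a = (uu : ℤ_[p]) * (p : ℤ_[p]) ^ a.valuation := PadicInt.unitCoeff_spec ha0
  set N := n' - a.valuation with hN
  have hφval : (κ (σ ^ p ^ N)).toAdd = (uu : ℤ_[p]) * (p : ℤ_[p]) ^ n' := by
    rw [map_pow, toAdd_pow, hκσ, nsmul_eq_mul, Nat.cast_pow, hau, hN, mul_comm, mul_assoc, ← pow_add,
      Nat.add_sub_cancel' hn']
  haveI : 𝔓.IsPrime := h𝔓.1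
  refine ⟨σ ^ p ^ N, ?_, ?_, ?_⟩
  · -- `σ ^ p ^ N` lies in the decomposition group of `𝔓`
    have h1 : σ ^ p ^ N ∈ MulAction.stabilizer (absoluteGaloisGroup ℚ) 𝔓 :=
      Subgroup.pow_mem _ hσ.mem_stabilizer _
    exact MulAction.mem_stabilizer_iff.mp h1
  · rw [ZpExtension.mem_layerSubgroup, hφval]
    exact Dvd.intro_left _ rfl
  · intro u hu
    rw [ZpExtension.mem_layerSubgroup] at hu
    obtain ⟨b, hb⟩ := hu
    haveI : NeZero (p ^ k) := ⟨pow_ne_zero _ hp.ne_zero⟩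
    set i : ℕ := (PadicInt.toZModPow k (b * ((uu⁻¹ : ℤ_[p]ˣ) : ℤ_[p]))).val with hi
    refine ⟨i, ?_⟩
    -- `p ^ k ∣ b - i • uu`
    have hdiv : (p : ℤ_[p]) ^ k ∣ b - (i : ℤ_[p]) * (uu : ℤ_[p]) := by
      have hmem : (i : ℤ_[p]) - b * ((uu⁻¹ : ℤ_[p]ˣ) : ℤ_[p]) ∈ RingHom.ker (PadicInt.toZModPow k) := by
        rw [RingHom.mem_ker, map_sub, map_natCast, hi, ZMod.natCast_zmod_val, sub_self]
      rw [PadicInt.ker_toZModPow, Ideal.mem_span_singleton] at hmem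
      have h2 := Dvd.dvd.mul_left hmem (uu : ℤ_[p])
      have h3 : (uu : ℤ_[p]) * ((i : ℤ_[p]) - b * ((uu⁻¹ : ℤ_[p]ˣ) : ℤ_[p])) =
          -(b - (i : ℤ_[p]) * (uu : ℤ_[p])) := by
        rw [mul_sub, ← mul_assoc, mul_comm (uu : ℤ_[p]) b, mul_assoc, Units.mul_inv, mul_one]
        ring
      rw [h3] at h2
      exact (dvd_neg.mp h2)
    rw [ZpExtension.mem_layerSubgroup, map_mul, map_inv, map_pow, toAdd_mul, toAdd_inv, toAdd_pow,
      hφval, hb, nsmul_eq_mul]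
    have h4 : -((i : ℤ_[p]) * ((uu : ℤ_[p]) * (p : ℤ_[p]) ^ n')) + (p : ℤ_[p]) ^ n' * b =
        (p : ℤ_[p]) ^ n' * (b - (i : ℤ_[p]) * (uu : ℤ_[p])) := by ring
    rw [h4, pow_add]
    exact mul_dvd_mul_left _ hdiv

end Generator

end Summit.BirchSwinnertonDyer.BirchSwinnertonDyer.Rank1Residual.UniversalNorms

end
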